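import Summits.Ventures.Crystal3D.Theorems.StickyWulffConstantTextureLiminfTexShadowLevelReachHexagonBarlowShapeTop
import Summits.Ventures.Crystal3D.Theorems.StickyWulffConstantTextureLiminfTexShadowLevelReachBornRoot
import Summits.Ventures.Crystal3D.Theorems.StickyWulffConstantCoaxialWallLawEndRowRootDischarge
import Summits.Ventures.Crystal3D.Theorems.StickyWulffConstantCoaxialWallLawEndRowJointDefs
import HarnessLib

/-!
# Both plates AND ABSTRACT end-pair families under ONE bi-frame row (the pooling step of the (β) census, census-output agnostic)
# (lane T, crux `TextureLiminfV5`, stmt-Ventures-23912, registered stub `stub_terraceCensus`; (β) assembly RESUME (d) — cf-p1 (cccxii))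

HONEST FRAMING. Venture `Summits/Ventures/Crystal3D` (cell `crystal3d-full`), route `route-Ventures-StickyWulffConstant`, helper `--supports` the law-v5
crux `TextureLiminfV5` (stmt-Ventures-23912), lane T, mechanism (β).  Census-free, certificate-free: the row `LocalEndRowA ver sF (basalSystem Fr) (basalSystem G₂)`
BY NAME; `KissingGap δ` / `KissingClassification δ` by name; nothing about energies; F-C1 not moved.

THE POINT.  `multiFamily_sources_le_payers_cuts` (…LevelReachMultiFamilyPooled, p753111) re-cut so that the born families enter as ABSTRACT END-PAIR SETS —
the OUTPUT of whichever born census produced them (`born_barlow_endPairs` p751718, `bornMoving_barlow_endPairs` p753363, their top twins, or any future variant):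
finitely many RISING families `T i` (`i : ι₁`), each a finite set of pairs of `X` with the window / two-payer clauses, a fixed direction `d i` (`bq.2 = bq.1 − d i`,
`(d i)₂ > 0`, pairwise distinct, none a basal direction of `Fr`) and the root-class end move in a frame `A i` presented in the plate systems' word nets
(`hadm₁ i : (basalSystem Fr).Adm (A i) (d i) ∨ (basalSystem G₂).Adm (A i) (d i)`); FALLING families `T' j` likewise w.r.t. `G₂`.  Together with the two plate
families (p747189, p751586) they are pairwise disjoint `IsEndPairA` sets of `(basalSystem Fr, basalSystem G₂)`, so ONE `card_endPairs_le_of_localRowA` gives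
**`platesFamilies_sources_le_payers_cuts`**:
`Σsrc₁ + Σsrc₂ + Σ_i #(T i) + Σ_j #(T' j) ≤ sF·Σ_PAYW(12 − deg) + ΣCUT₁ + ΣCUT₂ + #RT₁·rims + #RT₂·rims′`;
the born censuses' own inequalities `#B_i win ≤ #(T i) + CUT_i + rims` are then added by the caller (linear arithmetic).
WHAT THIS IS NOT: any born census, born SUPPLY, the flux/area conversion, any certificate; F-C1 not moved.
-/

noncomputable section

namespace Summit.Ventures.Crystal3D.Theorems

open Summit.Ventures.Crystal3D Finset
open Literature.MathematicalPhysics.StatisticalMechanics (barlowPos barlowStacking IsHaggSeq barlowPos_mem basalMirror)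
open Summit.Ventures.Crystal3D.Cruxes.TextureLiminf.TexShadow (E3 stacking)
open scoped InnerProductSpace

set_option maxHeartbeats 800000 in
open scoped Classical in
/-- **Both plates and abstract rising / falling end-pair families under ONE bi-frame row.**  See the module docstring. -/
theorem platesFamilies_sources_le_payers_cuts (ver : WordVersion) {δ : ℝ} (hg : KissingGap δ) (hc : KissingClassification δ)
    {σ₁ σ₂ : ℤ → ℤ} (hσ₁ : IsHaggSeq σ₁) (hσ₂ : IsHaggSeq σ₂) (L₁ L₂ : E3 ≃ₗᵢ[ℝ] E3) (s₁ s₂ : E3)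
    (Fr : E3 ≃ₗᵢ[ℝ] E3) {t : ℤ} (hFr : (t = 1 ∧ Fr = L₁) ∨ (t = -1 ∧ Fr = basalMirror.trans L₁))
    (G₂ : E3 ≃ₗᵢ[ℝ] E3) {t' : ℤ} (hG₂ : (t' = 1 ∧ G₂ = L₂) ∨ (t' = -1 ∧ G₂ = basalMirror.trans L₂))
    (hne₁ : (Fr : E3 → E3) '' ↑fccSlots ≠ (L₂ : E3 → E3) '' ↑fccSlots)
    (hne₂ : (Fr : E3 → E3) '' ↑fccSlots ≠ ((basalMirror.trans L₂ : E3 ≃ₗᵢ[ℝ] E3) : E3 → E3) '' ↑fccSlots)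
    (hne₁' : (G₂ : E3 → E3) '' ↑fccSlots ≠ (L₁ : E3 → E3) '' ↑fccSlots)
    (hne₂' : (G₂ : E3 → E3) '' ↑fccSlots ≠ ((basalMirror.trans L₁ : E3 ≃ₗᵢ[ℝ] E3) : E3 → E3) '' ↑fccSlots)
    {sF : ℝ} (hrow : LocalEndRowA ver sF (basalSystem Fr) (basalSystem G₂))
    (X P₁ P₂ : Finset E3) (R₀ h ρ : ℝ) (hR₀ : 5 ≤ R₀) (hρ : R₀ + 2 ≤ ρ)
    (hX : ∀ p ∈ X, ∀ q ∈ X, p ≠ q → 1 ≤ dist p q) (hP₁X : P₁ ⊆ X) (hP₂X : P₂ ⊆ X)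
    (hP₁ : ∀ p, p ∈ P₁ ↔ (p ∈ stacking L₁ s₁ σ₁ ∧ -(2 * R₀) ≤ p 2 ∧ p 2 ≤ -R₀ ∧ p 0 ^ 2 + p 1 ^ 2 ≤ ρ ^ 2))
    (hP₂ : ∀ p, p ∈ P₂ ↔ (p ∈ stacking L₂ s₂ σ₂ ∧ h + R₀ ≤ p 2 ∧ p 2 ≤ h + 2 * R₀ ∧ p 0 ^ 2 + p 1 ^ 2 ≤ ρ ^ 2))
    -- RISING abstract families
    {ι₁ : Type*} [Fintype ι₁] (A : ι₁ → (E3 ≃ₗᵢ[ℝ] E3)) (d : ι₁ → E3) (T : ι₁ → Finset (E3 × E3))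
    (hup : ∀ i, 0 < (d i) 2)
    (hadm₁ : ∀ i, (basalSystem Fr).Adm (A i) (d i) ∨ (basalSystem G₂).Adm (A i) (d i))
    (hdir₁ : ∀ i, ∀ r ∈ basalHexagon, d i ≠ Fr r) (hinj₁ : ∀ i i', d i = d i' → i = i')
    (hTpair : ∀ i, ∀ bq ∈ T i, bq.1 ∈ X ∧ bq.2 ∈ X ∧ dist bq.1 bq.2 = 1 ∧ -(R₀ + 1) - 1 ≤ bq.1 2 ∧ bq.1 2 ≤ h + (R₀ + 1) + 1)
    (hTpay : ∀ i, ∀ bq ∈ T i, (X.filter fun q => dist bq.1 q = 1).card ≤ 11 ∨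
      ∃ z₁ ∈ X, ∃ z₂ ∈ X, z₁ ≠ z₂ ∧ dist bq.1 z₁ = 1 ∧ dist bq.1 z₂ = 1 ∧
        (X.filter fun q => dist z₁ q = 1).card ≤ 11 ∧ (X.filter fun q => dist z₂ q = 1).card ≤ 11)
    (hTmove : ∀ i, ∀ bq ∈ T i, bq.2 = bq.1 - d i ∧ bq.2 - d i ∈ X ∧ IsEndMove X ver (A i) (d i) bq.2 bq.1)
    -- FALLING abstract families
    {ι₂ : Type*} [Fintype ι₂] (A' : ι₂ → (E3 ≃ₗᵢ[ℝ] E3)) (d' : ι₂ → E3) (T' : ι₂ → Finset (E3 × E3))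
    (hdown : ∀ j, (d' j) 2 < 0)
    (hadm₂ : ∀ j, (basalSystem Fr).Adm (A' j) (d' j) ∨ (basalSystem G₂).Adm (A' j) (d' j))
    (hdir₂ : ∀ j, ∀ r ∈ basalHexagon, d' j ≠ G₂ r) (hinj₂ : ∀ j j', d' j = d' j' → j = j')
    (hT'pair : ∀ j, ∀ bq ∈ T' j, bq.1 ∈ X ∧ bq.2 ∈ X ∧ dist bq.1 bq.2 = 1 ∧ -(R₀ + 1) - 1 ≤ bq.1 2 ∧ bq.1 2 ≤ h + (R₀ + 1) + 1)
    (hT'pay : ∀ j, ∀ bq ∈ T' j, (X.filter fun q => dist bq.1 q = 1).card ≤ 11 ∨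
      ∃ z₁ ∈ X, ∃ z₂ ∈ X, z₁ ≠ z₂ ∧ dist bq.1 z₁ = 1 ∧ dist bq.1 z₂ = 1 ∧
        (X.filter fun q => dist z₁ q = 1).card ≤ 11 ∧ (X.filter fun q => dist z₂ q = 1).card ≤ 11)
    (hT'move : ∀ j, ∀ bq ∈ T' j, bq.2 = bq.1 - d' j ∧ bq.2 - d' j ∈ X ∧ IsEndMove X ver (A' j) (d' j) bq.2 bq.1) :
    ((∑ r ∈ inPlaneRoots Fr 1,
        ((P₁.filter fun p => -(R₀ + 1) - 1 - 1 ≤ p 2 ∧ p 2 ≤ -(R₀ + 1) - 1 ∧ p 0 ^ 2 + p 1 ^ 2 ≤ (ρ - 1 - 1) ^ 2).filter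
          fun p => (∃ k i j : ℤ, p = L₁ (barlowPos 1 (Real.sqrt (2 / 3)) σ₁ k i j) + s₁ ∧ ¬ (σ₁ (k - 1) = -t ∧ σ₁ k = -t)) ∧
            -(R₀ + 1) - 1 < (p + Fr r) 2 ∧ (p + Fr r) 2 < h + (R₀ + 1) + 1).card : ℕ) : ℝ) +
      ((∑ r ∈ inPlaneRoots G₂ (-1),
        ((P₂.filter fun p => h + (R₀ + 1) + 1 ≤ p 2 ∧ p 2 ≤ h + (R₀ + 1) + 1 + 1 ∧ p 0 ^ 2 + p 1 ^ 2 ≤ (ρ - 1 - 1) ^ 2).filter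
          fun p => (∃ k i j : ℤ, p = L₂ (barlowPos 1 (Real.sqrt (2 / 3)) σ₂ k i j) + s₂ ∧ ¬ (σ₂ (k - 1) = -t' ∧ σ₂ k = -t')) ∧
            -(R₀ + 1) - 1 < (p + G₂ r) 2 ∧ (p + G₂ r) 2 < h + (R₀ + 1) + 1).card : ℕ) : ℝ) +
      ((∑ i, (T i).card : ℕ) : ℝ) + ((∑ j, (T' j).card : ℕ) : ℝ) ≤
      sF * ∑ z ∈ X.filter (fun z => (X.filter fun q => dist z q = 1).card ≤ 11 ∧
          -(R₀ + 1) - 2 ≤ z 2 ∧ z 2 ≤ h + (R₀ + 1) + 2), ((12 : ℝ) - ((X.filter fun q => dist z q = 1).card : ℝ)) +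
        ((∑ r ∈ inPlaneRoots Fr 1, (X.filter fun b => -(R₀ + 1) - 1 ≤ b 2 ∧ b 2 < h + (R₀ + 1) + 1 ∧
            (∃ μ, ⟪r, μ⟫_ℝ = Real.sqrt (2 / 3) ∧ IsTwinReading X Fr (Fr μ) b) ∧ b - Fr r ∈ X).card : ℕ) : ℝ) +
        ((∑ r ∈ inPlaneRoots G₂ (-1), (X.filter fun b => -(R₀ + 1) - 1 < b 2 ∧ b 2 ≤ h + (R₀ + 1) + 1 ∧
            (∃ μ, ⟪r, μ⟫_ℝ = Real.sqrt (2 / 3) ∧ IsTwinReading X G₂ (G₂ μ) b) ∧ b - G₂ r ∈ X).card : ℕ) : ℝ) +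
        ((inPlaneRoots Fr 1).card : ℝ) *
          (220 * ((X.filter fun s => h + (R₀ + 1) + 1 ≤ s 2 ∧ s 2 ≤ h + (R₀ + 1) + 1 + 1 ∧
              (ρ - 1 - 2) ^ 2 < s 0 ^ 2 + s 1 ^ 2).card : ℝ) +
            220 * ((X.filter fun s => -(R₀ + 1) - 1 - 1 ≤ s 2 ∧ s 2 < -(R₀ + 1) - 1 ∧
              (ρ - 1 - 1) ^ 2 < s 0 ^ 2 + s 1 ^ 2).card : ℝ)) +
        ((inPlaneRoots G₂ (-1)).card : ℝ) *
          (220 * ((X.filter fun s => -(R₀ + 1) - 1 - 1 ≤ s 2 ∧ s 2 ≤ -(R₀ + 1) - 1 ∧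
              (ρ - 1 - 2) ^ 2 < s 0 ^ 2 + s 1 ^ 2).card : ℝ) +
            220 * ((X.filter fun s => h + (R₀ + 1) + 1 < s 2 ∧ s 2 ≤ h + (R₀ + 1) + 1 + 1 ∧
              (ρ - 1 - 1) ^ 2 < s 0 ^ 2 + s 1 ^ 2).card : ℝ)) := by
  set S₁ : PlateSystem := basalSystem Fr with hS₁
  set S₂ : PlateSystem := basalSystem G₂ with hS₂
  -- (1) the two plate families
  obtain ⟨T₁, hkey₁, hT₁pair, hT₁pay, hT₁shape, hT₁wit⟩ := hexagon_barlow_endPairs_cuts_shape ver hg hc hσ₁ hσ₂ L₁ L₂ s₁ s₂ Fr hFr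
    hne₁ hne₂ X P₁ P₂ R₀ h ρ hR₀ hρ hX hP₁X hP₂X hP₁ hP₂
  obtain ⟨T₂, hkey₂, hT₂pair, hT₂pay, hT₂shape, hT₂adm⟩ := hexagon_barlow_endPairs_cuts_shape_top ver hg hc hσ₁ hσ₂ L₁ L₂ s₁ s₂ G₂ hG₂
    hne₁' hne₂' X P₁ P₂ R₀ h ρ hR₀ hρ hX hP₁X hP₂X hP₁ hP₂
  -- (2) vertical signs and directions
  have hsgn₁ : ∀ bq ∈ T₁, 0 < (bq.1 - bq.2) 2 := by
    intro bq hbq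
    obtain ⟨r', hr', hs, -⟩ := hT₁shape bq hbq
    have hu : 0 < (Fr r') 2 := by have := (mem_filter.1 hr').2.2; linarith
    have e : bq.1 - bq.2 = Fr r' := by rw [hs]; abel
    rw [e]; exact hu
  have hsgn₂ : ∀ bq ∈ T₂, (bq.1 - bq.2) 2 < 0 := by
    intro bq hbq
    obtain ⟨r', hr', hs⟩ := hT₂shape bq hbq
    have hd : (G₂ r') 2 < 0 := by have := (mem_filter.1 hr').2.2; linarith
    have e : bq.1 - bq.2 = G₂ r' := by rw [hs]; abel
    rw [e]; exact hd
  have hdirU : ∀ i, ∀ bq ∈ T i, bq.1 - bq.2 = d i := by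
    intro i bq hbq
    obtain ⟨hs, -, -⟩ := hTmove i bq hbq
    rw [hs]; abel
  have hdirD : ∀ j, ∀ bq ∈ T' j, bq.1 - bq.2 = d' j := by
    intro j bq hbq
    obtain ⟨hs, -, -⟩ := hT'move j bq hbq
    rw [hs]; abel
  -- (3) the pooled rising and falling sets
  set TU : Finset (E3 × E3) := T₁ ∪ Finset.univ.biUnion T with hTU
  set TD : Finset (E3 × E3) := T₂ ∪ Finset.univ.biUnion T' with hTD
  have hsgnU : ∀ bq ∈ TU, 0 < (bq.1 - bq.2) 2 := by
    intro bq hbq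
    rcases mem_union.1 hbq with h₁ | h₃
    · exact hsgn₁ bq h₁
    · obtain ⟨i, -, hi⟩ := mem_biUnion.1 h₃
      rw [hdirU i bq hi]; exact hup i
  have hsgnD : ∀ bq ∈ TD, (bq.1 - bq.2) 2 < 0 := by
    intro bq hbq
    rcases mem_union.1 hbq with h₂ | h₄
    · exact hsgn₂ bq h₂
    · obtain ⟨j, -, hj⟩ := mem_biUnion.1 h₄
      rw [hdirD j bq hj]; exact hdown j
  have hdisjUD : Disjoint TU TD := by
    rw [Finset.disjoint_left]
    intro bq h₁ h₂
    have := hsgnU bq h₁; have := hsgnD bq h₂; linarith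
  have hU_pair : (Set.univ : Set ι₁).PairwiseDisjoint T := by
    intro i _ i' _ hne
    rw [Function.onFun, Finset.disjoint_left]
    intro bq hi hi'
    exact hne (hinj₁ i i' ((hdirU i bq hi).symm.trans (hdirU i' bq hi')))
  have hD_pair : (Set.univ : Set ι₂).PairwiseDisjoint T' := by
    intro j _ j' _ hne
    rw [Function.onFun, Finset.disjoint_left]
    intro bq hj hj'
    exact hne (hinj₂ j j' ((hdirD j bq hj).symm.trans (hdirD j' bq hj')))
  have hT₁U : Disjoint T₁ (Finset.univ.biUnion T) := by
    rw [Finset.disjoint_left]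
    intro bq h₁ h₃
    obtain ⟨i, -, hi⟩ := mem_biUnion.1 h₃
    obtain ⟨r', hr', hs, -⟩ := hT₁shape bq h₁
    have e : bq.1 - bq.2 = Fr r' := by rw [hs]; abel
    exact hdir₁ i r' (inPlaneRoots_subset_basalHexagon Fr 1 hr') ((hdirU i bq hi).symm.trans e)
  have hT₂D : Disjoint T₂ (Finset.univ.biUnion T') := by
    rw [Finset.disjoint_left]
    intro bq h₂ h₄
    obtain ⟨j, -, hj⟩ := mem_biUnion.1 h₄
    obtain ⟨r', hr', hs⟩ := hT₂shape bq h₂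
    have e : bq.1 - bq.2 = G₂ r' := by rw [hs]; abel
    exact hdir₂ j r' (inPlaneRoots_subset_basalHexagon G₂ (-1) hr') ((hdirD j bq hj).symm.trans e)
  have hTUcard : TU.card = T₁.card + ∑ i, (T i).card := by
    rw [hTU, card_union_of_disjoint hT₁U, card_biUnion (fun i _ i' _ hne => hU_pair (Set.mem_univ i) (Set.mem_univ i') hne)]
  have hTDcard : TD.card = T₂.card + ∑ j, (T' j).card := by
    rw [hTD, card_union_of_disjoint hT₂D, card_biUnion (fun j _ j' _ hne => hD_pair (Set.mem_univ j) (Set.mem_univ j') hne)]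
  set TT := TU ∪ TD with hTT
  have hTTcard : TT.card = T₁.card + ∑ i, (T i).card + (T₂.card + ∑ j, (T' j).card) := by
    rw [hTT, card_union_of_disjoint hdisjUD, hTUcard, hTDcard]
  -- (4) every pooled pair is an (A)-end pair of (basalSystem Fr, basalSystem G₂)
  have hsub₁ : inPlaneRoots Fr 1 ⊆ basalHexagon := inPlaneRoots_subset_basalHexagon Fr 1
  have hsub₂ : inPlaneRoots G₂ (-1) ⊆ basalHexagon := inPlaneRoots_subset_basalHexagon G₂ (-1)
  -- `Adm` is monotone in the root set (inline; the tree lemma `PlateSystem.adm_mono` lives in the L12Local-tainted '…RowsOfJoint')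
  have adm_mono' : ∀ {G₀ : EuclideanSpace ℝ (Fin 3) ≃ₗᵢ[ℝ] EuclideanSpace ℝ (Fin 3)} {R R' : Finset (EuclideanSpace ℝ (Fin 3))},
      R ⊆ R' → ∀ {G : EuclideanSpace ℝ (Fin 3) ≃ₗᵢ[ℝ] EuclideanSpace ℝ (Fin 3)} {d : EuclideanSpace ℝ (Fin 3)},
      (⟨G₀, R⟩ : PlateSystem).Adm G d → (⟨G₀, R'⟩ : PlateSystem).Adm G d := by
    intro G₀ R R' h G d hadm
    obtain ⟨r, hr, κ, hκ, hG, hd⟩ := hadm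
    have e : (⟨G₀, R⟩ : PlateSystem).Fw κ = (⟨G₀, R'⟩ : PlateSystem).Fw κ :=
      PlateSystem.fw_eq_of_G₀ (S := ⟨G₀, R⟩) (S' := ⟨G₀, R'⟩) rfl κ
    exact ⟨r, h hr, κ, hκ, by rw [hG, e], by rw [hd, e]⟩
  have hEP : ∀ bq ∈ TT, IsEndPairA X ver S₁ S₂ bq.1 bq.2 := by
    intro bq hbq
    rcases mem_union.1 hbq with hU | hD
    · rcases mem_union.1 hU with h₁ | h₃
      · obtain ⟨hb, hq, -, -, -⟩ := hT₁pair bq h₁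
        obtain ⟨r, hr, κ, hWF, hpred, hmove⟩ := hT₁wit bq h₁
        have hadm : S₁.Adm ((⟨Fr, inPlaneRoots Fr 1⟩ : PlateSystem).Fw κ)
            ((⟨Fr, inPlaneRoots Fr 1⟩ : PlateSystem).Fw κ (((-1 : ℝ) ^ κ.length) • r)) :=
          adm_mono' hsub₁ ⟨r, hr, κ, hWF, rfl, rfl⟩
        exact ⟨hq, hb, hT₁pay bq h₁, _, _, Or.inl hadm, hpred, hmove⟩
      · obtain ⟨i, -, hi⟩ := mem_biUnion.1 h₃
        obtain ⟨hb, hq, -, -, -⟩ := hTpair i bq hi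
        obtain ⟨-, hpp, hmove⟩ := hTmove i bq hi
        exact isEndPairA_of_rootMove (hadm₁ i) hq hb (hTpay i bq hi) hpp hmove
    · rcases mem_union.1 hD with h₂ | h₄
      · obtain ⟨hb, hq, -, -, -⟩ := hT₂pair bq h₂
        obtain ⟨G', e', hadm, hpred, hmove⟩ := hT₂adm bq h₂
        exact ⟨hq, hb, hT₂pay bq h₂, G', e', Or.inr (adm_mono' hsub₂ hadm), hpred, hmove⟩
      · obtain ⟨j, -, hj⟩ := mem_biUnion.1 h₄
        obtain ⟨hb, hq, -, -, -⟩ := hT'pair j bq hj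
        obtain ⟨-, hpp, hmove⟩ := hT'move j bq hj
        exact isEndPairA_of_rootMove (hadm₂ j) hq hb (hT'pay j bq hj) hpp hmove
  -- (5) ONE application of the local row
  set PAYW := X.filter (fun z => (X.filter fun q => dist z q = 1).card ≤ 11 ∧
    -(R₀ + 1) - 2 ≤ z 2 ∧ z 2 ≤ h + (R₀ + 1) + 2) with hPAYW
  have hwin : ∀ bq ∈ TT, -(R₀ + 1) - 1 ≤ bq.1 2 ∧ bq.1 2 ≤ h + (R₀ + 1) + 1 := by
    intro bq hbq
    rcases mem_union.1 hbq with hU | hD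
    · rcases mem_union.1 hU with h₁ | h₃
      · obtain ⟨-, -, -, h4, h5⟩ := hT₁pair bq h₁; exact ⟨h4, h5.le⟩
      · obtain ⟨i, -, hi⟩ := mem_biUnion.1 h₃
        obtain ⟨-, -, -, h4, h5⟩ := hTpair i bq hi; exact ⟨h4, h5⟩
    · rcases mem_union.1 hD with h₂ | h₄
      · obtain ⟨-, -, -, h4, h5⟩ := hT₂pair bq h₂; exact ⟨h4.le, h5⟩
      · obtain ⟨j, -, hj⟩ := mem_biUnion.1 h₄
        obtain ⟨-, -, -, h4, h5⟩ := hT'pair j bq hj; exact ⟨h4, h5⟩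
  have hclosed : ∀ bq ∈ TT, ∀ z ∈ X, dist bq.1 z ≤ 1 → (X.filter fun q => dist z q = 1).card ≤ 11 → z ∈ PAYW := by
    intro bq hbq z hzX hdz hz11
    obtain ⟨h4, h5⟩ := hwin bq hbq
    have h2 : (z 2 - bq.1 2) ^ 2 ≤ 1 := by
      have := sq_sub_apply_le_dist_sq z bq.1 2
      rw [dist_comm] at hdz; nlinarith [this, hdz, dist_nonneg (x := z) (y := bq.1)]
    have h2' : |z 2 - bq.1 2| ≤ 1 := by rw [← sq_le_one_iff_abs_le_one]; exact h2
    obtain ⟨ha, hb⟩ := abs_le.1 h2'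
    exact mem_filter.2 ⟨hzX, hz11, by linarith, by linarith⟩
  have key := card_endPairs_le_of_localRowA hX ver S₁ S₂ TT PAYW hEP
    (fun z hz => ⟨(mem_filter.1 hz).1, (mem_filter.1 hz).2.1⟩) hclosed hrow
  -- (6) assemble
  rw [hTTcard] at key
  push_cast at key
  have hk₁ := (Nat.cast_le (α := ℝ)).2 hkey₁
  have hk₂ := (Nat.cast_le (α := ℝ)).2 hkey₂
  push_cast at hk₁ hk₂ ⊢
  linarith only [hk₁, hk₂, key]

end Summit.Ventures.Crystal3D.Theorems

end
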